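import Summits.BirchSwinnertonDyer.BirchSwinnertonDyer.Theorems.SmallImageMuTransferMuTransferX9StepOneImageH
import Literature.NumberTheory.EllipticCurves.IwasawaTwistModPCentralHomothety
import Literature.NumberTheory.GaloisRepresentations.ContinuousH1SahOpenNormal
import Literature.NumberTheory.EllipticCurves.ModPImageScalarProofs
import Literature.NumberTheory.EllipticCurves.GaloisActionProofs
import HarnessLib

/-!
# Step 1 of the `μ`-transfer core (`stub_coreX9`, crux 19276): (F8) discharged on class X9

HOME/koly/MU-TRANSFER-PROOF.md (F8) on the GENUINE objects, for `E/ℚ` with `E[p]` irreducible,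
`ρ̄_{E,p}` not surjective and `p ≥ 5` (class X9 at `p ∈ {5, 7}`): with `N_J := ker(Γ_ℚ → Aut 𝒯_J(E))`
(open, normal, acting trivially on `𝒯_J(E)`), every continuous 1-cocycle of `E[p]` with non-zero
class is non-zero on `N_J` (`exists_mem_ker_apply_ne_zero`): Sah's lemma with the non-trivial
central homothety `z`, `ρ̄(z) = a ≠ 1` (tree `exists_galoisRepTorsion_eq_smul_of_not_surjective`),
central modulo `N_J` (`mk_mem_center_quotient_ker_of_smul`) and without fixed vector
(`eq_zero_of_smul_eq_of_prime`). Consequently (`valueSubgroup_ker_eq_top`) the STEP 1 conclusion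
`im h = 𝒯_{J+1}(E)` holds for `S = N_{J+1}` with NO residual hypothesis beyond `κ̄' ≠ 0`.

PARTITION (D-0054): X9 (A4) — helper toward `stub_coreX9`; closes none.
-/

set_option linter.dupNamespace false

noncomputable section

open Literature.NumberTheory.EllipticCurves Literature.NumberTheory.GaloisRepresentations Field
  Function

namespace Summit.BirchSwinnertonDyer.BirchSwinnertonDyer.Rank1Residual.LevelE

variable (W : WeierstrassCurve ℚ) [W.IsElliptic] (p : ℕ) [Fact p.Prime] (κ : ZpExtension ℚ p)

/-- **The central homothety of a non-surjective irreducible image has no fixed vector and is a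
scalar on `E[p]`** (`p ≥ 5`): `∃ z a, (∀ m, z•m = a•m) ∧ (∀ m, z•m = m → m = 0)`.
[cite: Serre1972, §2.4 Prop. 15] [cite: Sah1968, Prop. 2.7 (b)] -/
theorem exists_homothety_noFixedVector (hp5 : 5 ≤ p) (hirr : W.HasIrreducibleModPGaloisRep p)
    (hns : ¬ W.HasSurjectiveModNGaloisRep p) :
    ∃ (z : absoluteGaloisGroup ℚ) (a : ℤ),
      (∀ m : WeierstrassCurve.geomTorsion W (p : ℤ), W.torsionGaloisModule (p : ℤ) z m = a • m) ∧
      (∀ m : WeierstrassCurve.geomTorsion W (p : ℤ), W.torsionGaloisModule (p : ℤ) z m = m → m = 0) := by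
  have hp : p.Prime := Fact.out
  obtain ⟨z, a, ha1, hz⟩ := W.exists_galoisRepTorsion_eq_smul_of_not_surjective p hp5 hirr hns
  have hz' : ∀ m : WeierstrassCurve.geomTorsion W (p : ℤ),
      W.torsionGaloisModule (p : ℤ) z m = (a.val : ℤ) • m := fun m => by
    rw [WeierstrassCurve.torsionGaloisModule_apply_apply, ← WeierstrassCurve.galoisRepTorsion_apply,
      hz m, natCast_zsmul]
  refine ⟨z, (a.val : ℤ), hz', fun m hm => ?_⟩
  have hdvd : ¬ (p : ℤ) ∣ (a.val : ℤ) - 1 := by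
    intro h
    apply ha1
    have h0 : (((a.val : ℤ) - 1 : ℤ) : ZMod p) = 0 := (ZMod.intCast_zmod_eq_zero_iff_dvd _ p).mpr h
    rw [Int.cast_sub, Int.cast_natCast, ZMod.natCast_zmod_val, Int.cast_one, sub_eq_zero] at h0
    exact h0
  exact eq_zero_of_smul_eq_of_prime hp (AddSubgroup.torsionBy.nsmul m) hdvd ((hz' m).symm.trans hm)

/-- **(F8) on class X9: non-zero classes of `E[p]` are non-zero on `N_J = ker(Γ_ℚ → Aut 𝒯_J(E))`.**
(Sah with the central homothety; `N_J` open since `E[p]` is finite.) This is hypothesis `hSah` of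
`valueSubgroup_eq_top_of_towerConst_ne_zero` for `S = N_J`.
[cite: Sah1968, Prop. 2.7 (b)] [cite: NeukirchSchmidtWingberg2008, (1.6.7)] [cite: Serre1972, §2.4 Prop. 15] -/
theorem exists_mem_ker_apply_ne_zero (hp5 : 5 ≤ p) (hirr : W.HasIrreducibleModPGaloisRep p)
    (hns : ¬ W.HasSurjectiveModNGaloisRep p) (J : ℕ)
    (ψ : contOneCocycles (W.torsionGaloisModule (p : ℤ)).toTopRep)
    (hψ : oneCocycleClass (W.torsionGaloisModule (p : ℤ)).toTopRep ψ ≠ 0) :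
    ∃ τ ∈ (κ.twistModPRepresentation (W.torsionGaloisModule (p : ℤ))
        (fun P : WeierstrassCurve.geomTorsion W (p : ℤ) => AddSubgroup.torsionBy.nsmul P) J).ker,
      ψ.1 τ ≠ 0 := by
  have hp : p.Prime := Fact.out
  haveI : Finite (WeierstrassCurve.geomTorsion W (p : ℤ)) :=
    WeierstrassCurve.finite_torsionPoints_holds W (AlgebraicClosure ℚ) (by exact_mod_cast hp.ne_zero)
  obtain ⟨z, a, hza, hz0⟩ := exists_homothety_noFixedVector W p hp5 hirr hns
  exact galoisCohomology.exists_mem_apply_ne_zero_of_isOpen (W.torsionGaloisModule (p : ℤ)) _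
    (κ.isOpen_ker_twistModPRepresentation (W.torsionGaloisModule (p : ℤ)) _ J)
    (κ.mk_mem_center_quotient_ker_of_smul (W.torsionGaloisModule (p : ℤ)) _ J hza) hz0 ψ hψ

/-- **STEP 1, `im h = 𝒯_{J+1}(E)` on class X9 with no residual hypothesis** (`p ≥ 5`): for
`κ' ∈ 𝐇¹_Ω(E[p])` with `κ̄' ≠ 0` and `φ` representing `κ'_{J+1}`, the value group of `φ` on
`N_{J+1} = ker(Γ_ℚ → Aut 𝒯_{J+1}(E))` is all of `𝒯_{J+1}(E)`.
[cite: Serre1972, §2.4 Prop. 15] [cite: MazurRubin2004, §5.3] [cite: Sah1968, Prop. 2.7 (b)] -/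
theorem valueSubgroup_ker_eq_top (hp5 : 5 ≤ p) (hirr : W.HasIrreducibleModPGaloisRep p)
    (hns : ¬ W.HasSurjectiveModNGaloisRep p) {γ : absoluteGaloisGroup ℚ} (hγ : κ.IsTopGenerator γ)
    (y : κ.twistTower (W.torsionGaloisModule (p : ℤ))
      (fun P : WeierstrassCurve.geomTorsion W (p : ℤ) => AddSubgroup.torsionBy.nsmul P))
    (hy : κ.towerConst (W.torsionGaloisModule (p : ℤ)) (fun P => AddSubgroup.torsionBy.nsmul P) y ≠ 0)
    (J : ℕ) (φ : contOneCocycles (W.modPTwist p κ (J + 1)).toTopRep)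
    (hφ : oneCocycleClass (W.modPTwist p κ (J + 1)).toTopRep φ = y.1 (J + 1)) :
    contOneCocycles.valueSubgroup φ
      (κ.twistModPRepresentation (W.torsionGaloisModule (p : ℤ))
        (fun P : WeierstrassCurve.geomTorsion W (p : ℤ) => AddSubgroup.torsionBy.nsmul P) (J + 1)).ker
      (fun _ hτ x => κ.toTopRep_ρ_apply_eq_self_of_mem_ker (W.torsionGaloisModule (p : ℤ)) _ (J + 1)
        hτ x) = ⊤ :=
  valueSubgroup_eq_top_of_towerConst_ne_zero W p κ hirr hns hγ y hy J φ hφ _ _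
    (fun ψ hψ => exists_mem_ker_apply_ne_zero W p κ hp5 hirr hns (J + 1) ψ hψ)

end Summit.BirchSwinnertonDyer.BirchSwinnertonDyer.Rank1Residual.LevelE

end
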